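import Mathlib
import HarnessLib
import Literature.MathematicalPhysics.StatisticalMechanics.BarlowStacking
import Literature.MathematicalPhysics.StatisticalMechanics.HaggStacking
import Summits.AtomisticToContinuum.Crystallization.Theorems.ChartedPlanarOrderDefectEventGeometry

/-!
# The parameter space of flexible-gap layered templates is compact; pattern points are continuous;
# a uniform index box at every radius

`Theses`-free, DEF-FREE toolkit over `ChartedPlanarOrderDefectEventGeometry` (`Param`, `piSet`, `pt`, `ptL`,
`patVec`, `index_box`), for the Borel measurability of the matched-root event (`ChartedPlanarOrderMatchedRootBorel.lean`,
decomp-a2c lens-3 g21 plan «MatchedRootBorel», hand-1 g8):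

* (private) `abs_haggLabel_le` — `|haggLabel s m| ≤ |m|` for a `±1` word (the tree's `GscHingeGlue` copy is not co-importable);
* `abs_height_le` — heights of an admissible gap sequence satisfy `|z m| ≤ |m|`;
* `exists_index_finset` — **uniform index box at every radius**: for every `R` there is a finite set `B` of indices such that
  for EVERY admissible parameter `π ∈ piSet`, every pattern point `pt π k` of norm `≤ R` has `k ∈ B`;
* `continuous_pt` — `π ↦ pt π k` is continuous on the whole parameter space (the letter label is locally constant in the
  product topology of `ℤ → ℤ`, `pt_eq_ptL` + `continuous_ptL`);
* `isClosed_piSet`, `isCompact_piSet` — the admissible parameters form a COMPACT set (scale in `[9/10, 1]`, norm-preserving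
  frames in the unit operator ball of a finite-dimensional space, `±1` words and coordinatewise-bounded heights by Tychonoff).

Filed `--supports stmt-AtomisticToContinuum-26636` (helper).  Elementary ([folklore]); axioms standard.
-/

noncomputable section

namespace Summit.AtomisticToContinuum.Crystallization.Theorems.ChartedPlanarOrderMatchedRootBorel

open Metric Set Filter Topology
open Literature.MathematicalPhysics.StatisticalMechanics
open Summit.AtomisticToContinuum.Crystallization.Theorems.ChartedPlanarOrderDefectEventGeometry

/-! ## Words and heights -/

/-- window sums of a `±1` word are bounded by the window length (private copy of `GscHingeGlue.abs_haggWindow_le`, whose module is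
unbuilt on the farm and import-incompatible with this lineage — `MuGroundStateConfiguration` vs `MuGSC`). [folklore] -/
private theorem abs_haggWindow_le {s : ℤ → ℤ} (hs : IsHaggSeq s) (m₀ : ℤ) (k : ℕ) : |haggWindow s m₀ k| ≤ k := by
  unfold haggWindow
  refine (Finset.abs_sum_le_sum_abs _ _).trans ?_
  have : ∀ i ∈ Finset.range k, |s (m₀ + i)| ≤ 1 := by
    intro i _
    rcases hs (m₀ + i) with h | h <;> simp [h]
  calc ∑ i ∈ Finset.range k, |s (m₀ + ↑i)| ≤ ∑ _i ∈ Finset.range k, (1 : ℤ) := Finset.sum_le_sum this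
    _ = k := by simp

/-- letter labels of a `±1` word: `|haggLabel s m| ≤ |m|` (private copy of `GscHingeGlue.abs_haggLabel_le`, same reason). [folklore] -/
private theorem abs_haggLabel_le {s : ℤ → ℤ} (hs : IsHaggSeq s) (m : ℤ) : |haggLabel s m| ≤ |m| := by
  unfold haggLabel
  split_ifs with hm
  · have := abs_haggWindow_le hs 0 m.toNat
    rw [show ((m.toNat : ℕ) : ℤ) = m from Int.toNat_of_nonneg hm] at this
    exact this.trans (le_abs_self m)
  · rw [abs_neg]
    have := abs_haggWindow_le hs m (-m).toNat
    have hneg : 0 ≤ -m := by omega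
    rw [show (((-m).toNat : ℕ) : ℤ) = -m from Int.toNat_of_nonneg hneg] at this
    exact this.trans (neg_le_abs m)

/-- heights of a gap sequence with `z 0 = 0` and gaps in `[0, 1]` satisfy `|z m| ≤ |m|`. [folklore] -/
theorem abs_height_le {z : ℤ → ℝ} (hlo : ∀ m : ℤ, 0 ≤ z (m + 1) - z m) (hhi : ∀ m : ℤ, z (m + 1) - z m ≤ 1)
    (hz0 : z 0 = 0) (m : ℤ) : |z m| ≤ |(m : ℝ)| := by
  have hpos : ∀ n : ℕ, 0 ≤ z n ∧ z n ≤ n := by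
    intro n
    induction n with
    | zero => simp [hz0]
    | succ n ih =>
      have h1 := hlo n
      have h2 := hhi n
      push_cast at h1 h2 ⊢
      constructor <;> linarith [ih.1, ih.2]
  have hneg : ∀ n : ℕ, 0 ≤ -z (-(n : ℤ)) ∧ -z (-(n : ℤ)) ≤ n := by
    intro n
    induction n with
    | zero => simp [hz0]
    | succ n ih =>
      have h1 := hlo (-(n + 1 : ℕ))
      have h2 := hhi (-(n + 1 : ℕ))
      have h3 : (-(n + 1 : ℕ) : ℤ) + 1 = -(n : ℤ) := by push_cast; ring
      rw [h3] at h1 h2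
      push_cast at h1 h2 ih ⊢
      constructor <;> linarith [ih.1, ih.2]
  rcases le_or_gt 0 m with hm | hm
  · obtain ⟨n, rfl⟩ := Int.eq_ofNat_of_zero_le hm
    have h := hpos n
    rw [Int.cast_natCast, Nat.abs_cast, abs_of_nonneg h.1]
    exact h.2
  · obtain ⟨n, hn⟩ := Int.exists_eq_neg_ofNat (le_of_lt hm)
    subst hn
    have h := hneg n
    rw [Int.cast_neg, Int.cast_natCast, abs_neg, Nat.abs_cast]
    have : |z (-(n : ℤ))| = -z (-(n : ℤ)) := by
      rw [abs_of_nonpos (by linarith [h.1])]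
    rw [this]
    exact h.2

/-! ## The uniform index box at every radius -/

/-- coordinate bounds of a pattern point of norm `≤ R` of an ADMISSIBLE parameter: `|m|, |j| ≤ 2R` and `|i| ≤ 4R`. [folklore] -/
theorem index_bounds {π : Param} (hπ : π ∈ piSet) {R : ℝ} {k : ℤ × ℤ × ℤ} (hk : ‖pt π k‖ ≤ R) :
    |(k.1 : ℝ)| ≤ 2 * R ∧ |(k.2.2 : ℝ)| ≤ 2 * R ∧ |(k.2.1 : ℝ)| ≤ 4 * R := by
  obtain ⟨hb, hb1, hA, hs, hgap, hz0⟩ := hπ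
  obtain ⟨m, i, j⟩ := k
  set b := π.1 with hbdef
  set v := patVec b (haggLabel π.2.2.1 m) (π.2.2.2 m) i j with hv
  have hn : ‖v‖ ≤ R := by
    have : ‖pt π (m, i, j)‖ = ‖v‖ := by
      show ‖π.2.1 (patVec π.1 (haggLabel π.2.2.1 m) (π.2.2.2 m) i j)‖ = ‖v‖
      rw [hA]
    rw [← this]; exact hk
  have hR : 0 ≤ R := (norm_nonneg _).trans hn
  -- layer index
  have h2 : |π.2.2.2 m| ≤ R := by
    have : |v 2| ≤ ‖v‖ := by simpa using PiLp.norm_apply_le v 2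
    rw [hv, patVec_apply_two] at this
    exact this.trans hn
  have hzm := height_bound (fun m => (hgap m).1) hz0 m
  have hmR : |(m : ℝ)| ≤ 2 * R := by
    have h0 : 0 ≤ |(m : ℝ)| := abs_nonneg _
    nlinarith
  -- letter label
  have hlabZ : |haggLabel π.2.2.1 m| ≤ |m| := abs_haggLabel_le hs m
  have hlab : |(haggLabel π.2.2.1 m : ℝ)| ≤ 2 * R := by
    have : |(haggLabel π.2.2.1 m : ℝ)| ≤ |(m : ℝ)| := by
      rw [← Int.cast_abs, ← Int.cast_abs]; exact_mod_cast hlabZ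
    exact this.trans hmR
  -- coordinate 1
  have h1 : |b * √3 / 2 * (j + haggLabel π.2.2.1 m / 3)| ≤ R := by
    have : |v 1| ≤ ‖v‖ := by simpa using PiLp.norm_apply_le v 1
    rw [hv, patVec_apply_one] at this
    exact this.trans hn
  have h3 : (√3 : ℝ) ^ 2 = 3 := Real.sq_sqrt (by norm_num)
  have hs0 : (0 : ℝ) ≤ √3 := Real.sqrt_nonneg 3
  have hjR : |(j : ℝ)| ≤ 2 * R := by
    set X : ℝ := (j : ℝ) + haggLabel π.2.2.1 m / 3 with hX
    have hsq : (b * √3 / 2 * X) ^ 2 ≤ R ^ 2 := by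
      have := abs_le.mp h1
      nlinarith
    have hsq' : b ^ 2 * 3 / 4 * X ^ 2 ≤ R ^ 2 := by
      have h := hsq
      rw [show (b * √3 / 2 * X) ^ 2 = b ^ 2 * (√3) ^ 2 / 4 * X ^ 2 by ring, h3] at h
      linarith
    have hkey : X ^ 2 ≤ (4 * R / 3) ^ 2 := by
      have hb2 : (81 : ℝ) / 100 ≤ b ^ 2 := by nlinarith
      have hb2x : 81 / 100 * X ^ 2 ≤ b ^ 2 * X ^ 2 := mul_le_mul_of_nonneg_right hb2 (sq_nonneg X)
      nlinarith [sq_nonneg X, sq_nonneg R]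
    obtain ⟨hl, hu⟩ := abs_le_of_sq_le_sq' hkey (by positivity)
    have hh := abs_le.mp hlab
    rw [abs_le]; constructor <;> linarith [hh.1, hh.2]
  -- coordinate 0
  have h0 : |b * (i + j / 2 + haggLabel π.2.2.1 m / 2)| ≤ R := by
    have : |v 0| ≤ ‖v‖ := by simpa using PiLp.norm_apply_le v 0
    rw [hv, patVec_apply_zero] at this
    exact this.trans hn
  have hiR : |(i : ℝ)| ≤ 4 * R := by
    have hb0 : 0 < b := by linarith
    have hin : |(i : ℝ) + j / 2 + haggLabel π.2.2.1 m / 2| ≤ R / b := by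
      rw [abs_mul, abs_of_pos hb0] at h0
      rw [le_div_iff₀ hb0]; linarith
    have hRb : R / b ≤ 10 / 9 * R := by
      rw [div_le_iff₀ hb0]; nlinarith
    have hj := abs_le.mp hjR
    have hl := abs_le.mp hlab
    have hh := abs_le.mp (hin.trans hRb)
    rw [abs_le]; constructor <;> linarith [hj.1, hj.2, hl.1, hl.2, hh.1, hh.2]
  exact ⟨hmR, hjR, hiR⟩

/-- **Uniform index box at every radius.** For every `R` there is a finite set `B` of indices such that for EVERY admissible
parameter `π ∈ piSet`, every pattern point of norm `≤ R` has its index in `B`. [folklore] -/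
theorem exists_index_finset (R : ℝ) :
    ∃ B : Finset (ℤ × ℤ × ℤ), ∀ π ∈ piSet, ∀ k : ℤ × ℤ × ℤ, ‖pt π k‖ ≤ R → k ∈ B := by
  set N : ℕ := ⌈4 * R⌉₊ with hN
  refine ⟨Finset.Icc (-(N : ℤ)) N ×ˢ (Finset.Icc (-(N : ℤ)) N ×ˢ Finset.Icc (-(N : ℤ)) N), fun π hπ k hk => ?_⟩
  obtain ⟨hm, hj, hi⟩ := index_bounds hπ hk
  have hR : 0 ≤ R := (norm_nonneg _).trans hk
  have hNR : 4 * R ≤ (N : ℝ) := Nat.le_ceil _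
  have cast_le : ∀ a : ℤ, |(a : ℝ)| ≤ 4 * R → a ∈ Finset.Icc (-(N : ℤ)) N := by
    intro a ha
    have h' : |(a : ℝ)| ≤ ((N : ℤ) : ℝ) := by
      push_cast; exact ha.trans hNR
    have h'' : |a| ≤ (N : ℤ) := by exact_mod_cast h'
    exact Finset.mem_Icc.mpr (abs_le.mp h'')
  refine Finset.mem_product.mpr ⟨cast_le _ (hm.trans (by linarith)), Finset.mem_product.mpr ⟨cast_le _ hi, cast_le _ (hj.trans (by linarith))⟩⟩

/-- the pattern points of an admissible parameter in a ball form a finite family of indices. [folklore] -/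
theorem finite_index_norm_le {π : Param} (hπ : π ∈ piSet) (R : ℝ) : {k : ℤ × ℤ × ℤ | ‖pt π k‖ ≤ R}.Finite := by
  obtain ⟨B, hB⟩ := exists_index_finset R
  exact (B.finite_toSet).subset fun k hk => hB π hπ k hk

/-! ## Continuity of the pattern points on the parameter space -/

/-- `π ↦ pt π k` is continuous on the parameter space (the letter label `haggLabel π.2.2.1 k.1` is locally constant in the
product topology of `ℤ → ℤ`). [folklore] -/
theorem continuous_pt (k : ℤ × ℤ × ℤ) : Continuous fun π : Param => pt π k := by
  refine continuous_iff_continuousAt.mpr fun π₀ => ?_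
  set s₀ : ℤ → ℤ := π₀.2.2.1 with hs₀
  set M : ℕ := k.1.natAbs with hM
  -- the open set of parameters whose word agrees with `s₀` on `[-M, M]`
  have hV : IsOpen {π : Param | ∀ i ∈ Finset.Icc (-(M : ℤ)) M, π.2.2.1 i = s₀ i} := by
    have : {π : Param | ∀ i ∈ Finset.Icc (-(M : ℤ)) M, π.2.2.1 i = s₀ i} =
        ⋂ i ∈ Finset.Icc (-(M : ℤ)) M, {π : Param | π.2.2.1 i = s₀ i} := by
      ext π; simp only [Set.mem_setOf_eq, Set.mem_iInter]
    rw [this]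
    refine isOpen_biInter_finset fun i _ => ?_
    have hci : Continuous fun π : Param => π.2.2.1 i :=
      (continuous_apply i).comp (continuous_fst.comp (continuous_snd.comp continuous_snd))
    exact (isOpen_discrete ({s₀ i} : Set ℤ)).preimage hci
  have hmem : π₀ ∈ {π : Param | ∀ i ∈ Finset.Icc (-(M : ℤ)) M, π.2.2.1 i = s₀ i} := fun i _ => rfl
  have heq : (fun π : Param => pt π k) =ᶠ[𝓝 π₀] ptL s₀ k := by
    filter_upwards [hV.mem_nhds hmem] with π hπ
    refine pt_eq_ptL (M := M) (fun i hi => hπ i (Finset.mem_Icc.mpr (abs_le.mp hi))) ?_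
    rw [hM]; exact le_of_eq (Int.abs_eq_natAbs k.1)
  exact ((continuous_ptL s₀ k).continuousAt.congr heq.symm :)

/-! ## Compactness of the admissible parameters -/

/-- `piSet` is closed. [folklore] -/
theorem isClosed_piSet : IsClosed (piSet : Set Param) := by
  have hA : Continuous fun π : Param => π.2.1 := continuous_fst.comp continuous_snd
  have hs : ∀ i : ℤ, Continuous fun π : Param => π.2.2.1 i := fun i =>
    (continuous_apply i).comp (continuous_fst.comp (continuous_snd.comp continuous_snd))
  have hz : ∀ m : ℤ, Continuous fun π : Param => π.2.2.2 m := fun m =>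
    (continuous_apply m).comp (continuous_snd.comp (continuous_snd.comp continuous_snd))
  have h1 : IsClosed {π : Param | 9 / 10 ≤ π.1} := isClosed_le continuous_const continuous_fst
  have h2 : IsClosed {π : Param | π.1 ≤ 1} := isClosed_le continuous_fst continuous_const
  have h3 : IsClosed {π : Param | ∀ v, ‖π.2.1 v‖ = ‖v‖} := by
    rw [Set.setOf_forall]
    exact isClosed_iInter fun v => isClosed_eq (hA.clm_apply continuous_const).norm continuous_const
  have h4 : IsClosed {π : Param | IsHaggSeq π.2.2.1} := by
    have : {π : Param | IsHaggSeq π.2.2.1} = ⋂ i : ℤ, (fun π : Param => π.2.2.1 i) ⁻¹' ({1, -1} : Set ℤ) := by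
      ext π
      simp only [IsHaggSeq, Set.mem_setOf_eq, Set.mem_iInter, Set.mem_preimage, Set.mem_insert_iff,
        Set.mem_singleton_iff]
    rw [this]
    exact isClosed_iInter fun i => (isClosed_discrete _).preimage (hs i)
  have h5 : IsClosed {π : Param | ∀ m : ℤ, 39 / 50 * π.1 ≤ π.2.2.2 (m + 1) - π.2.2.2 m ∧
      π.2.2.2 (m + 1) - π.2.2.2 m ≤ 17 / 20 * π.1} := by
    rw [Set.setOf_forall]
    refine isClosed_iInter fun m => ?_
    rw [Set.setOf_and]
    exact (isClosed_le (continuous_const.mul continuous_fst) ((hz _).sub (hz _))).inter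
      (isClosed_le ((hz _).sub (hz _)) (continuous_const.mul continuous_fst))
  have h6 : IsClosed {π : Param | π.2.2.2 0 = 0} := isClosed_eq (hz 0) continuous_const
  have : (piSet : Set Param) = {π : Param | 9 / 10 ≤ π.1} ∩ {π : Param | π.1 ≤ 1} ∩
      {π : Param | ∀ v, ‖π.2.1 v‖ = ‖v‖} ∩ {π : Param | IsHaggSeq π.2.2.1} ∩
      {π : Param | ∀ m : ℤ, 39 / 50 * π.1 ≤ π.2.2.2 (m + 1) - π.2.2.2 m ∧
        π.2.2.2 (m + 1) - π.2.2.2 m ≤ 17 / 20 * π.1} ∩ {π : Param | π.2.2.2 0 = 0} := by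
    ext π
    simp only [piSet, Set.mem_setOf_eq, Set.mem_inter_iff, and_assoc]
  rw [this]
  exact ((((h1.inter h2).inter h3).inter h4).inter h5).inter h6

/-- **The admissible parameters form a compact set** (Heine–Borel in the scale and the frame, Tychonoff in the word and the
heights). [folklore] -/
theorem isCompact_piSet : IsCompact (piSet : Set Param) := by
  set C : Set Param := Set.Icc (9 / 10 : ℝ) 1 ×ˢ ((closedBall (0 : EuclideanSpace ℝ (Fin 3) →L[ℝ] EuclideanSpace ℝ (Fin 3)) 1) ×ˢ
    ((Set.pi Set.univ fun _ : ℤ => ({1, -1} : Set ℤ)) ×ˢ (Set.pi Set.univ fun m : ℤ => Set.Icc (-|(m : ℝ)|) |(m : ℝ)|)))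
    with hC
  have hCc : IsCompact C := by
    rw [hC]
    refine isCompact_Icc.prod ((isCompact_closedBall _ _).prod
      ((isCompact_univ_pi fun _ => ?_).prod (isCompact_univ_pi fun m => isCompact_Icc)))
    exact (Set.toFinite _).isCompact
  refine hCc.of_isClosed_subset isClosed_piSet fun π hπ => ?_
  obtain ⟨hb, hb1, hA, hs, hgap, hz0⟩ := hπ
  rw [hC]
  refine ⟨⟨hb, hb1⟩, ?_, ?_, ?_⟩
  · rw [mem_closedBall, dist_zero_right]
    exact ContinuousLinearMap.opNorm_le_bound _ zero_le_one fun v => by rw [hA, one_mul]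
  · exact Set.mem_univ_pi.mpr fun i => by
      rcases hs i with h | h <;> simp [h]
  · refine Set.mem_univ_pi.mpr fun m => ?_
    have hb0 : 0 ≤ π.1 := by linarith
    have := abs_height_le (z := π.2.2.2) (fun m => by nlinarith [(hgap m).1])
      (fun m => by nlinarith [(hgap m).2]) hz0 m
    exact ⟨by linarith [(abs_le.mp this).1], (abs_le.mp this).2⟩

end Summit.AtomisticToContinuum.Crystallization.Theorems.ChartedPlanarOrderMatchedRootBorel

end
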